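import Summits.QuantumFields.YangMills.Theorems.ReplicaVarianceTiltHeightChiSqLHaarDominated
import Literature.MathematicalPhysics.QuantumFieldTheory.Balaban1983to89.T4QuatExpLog

/-!
# Route `ReplicaVarianceTilt` — crux `HeightChiSqL` (stmt-QuantumFields-26133), toward the residual of `stub_acIntegrable`:
# QUANTITATIVE LEMMA A ON `SU(2)`, MATRIX FORM — an ambient matrix map with a TANGENT FLOOR (`L²`-operator norm) and a finite
# injectivity cover pushes restricted Haar measure to a DOMINATED measure (helper `--supports stmt-QuantumFields-26133`)

Width seat `ym-line-sfw-p2-w3` gen 21 (home cell `ym-idea-1`; R3 RECORD rung — no summit, no rung and no crux is proved here; the YM mass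
gap is NOT proved by any of this).  Companion of `ReplicaVarianceTiltHeightChiSqLHaarDominated` (quaternion form), stated on an ambient map
`K♯ : M₂(ℂ) → M₂(ℂ)` exactly as the tree's qualitative `T4HaarSU2LocalDiffeo.haar_restrict_map_absolutelyContinuous_of_matrix`, so that the
binder shape matches `T4EMLTangentInjective` (`hasStrictFDerivAt_Kmat`, `emlD`): the hypothesis «`D W` kills no non-zero tangent vector
`↑W·X`» is replaced by the TANGENT FLOOR `c‖X‖ ≤ ‖D W (↑W·X)‖` for skew-Hermitian traceless `X` (`0 < c ≤ 1`, `L²`-operator norm), and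
absolute continuity by DOMINATION `((Haar).restrict S).map K ≤ (n·(ofReal c⁴)⁻¹) • Haar` given a cover of `S` by `n` measurable pieces on
which `K` is injective (`haar_restrict_map_le_smul_of_matrix`).  Transfer: the quaternion dictionary is an `L²`-operator-norm isometry
(`T4QuatExpLog.norm_quatMatrix`), tangent vectors at `quatMatrix u` are `quatMatrix u · quatMatrix (ū v)`, `v ⊥ u`
(`T4HaarSU2LocalDiffeo.quatMatrix_tangent`), and the derivative maps them into quaternion matrices
(`T4HaarSU2LocalDiffeo.apply_quatMatrix_eq_of_tangent`).  Every declaration is [folklore]; no estimate of Bałaban's is used.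
WHAT IS LEFT for the stub: for `K♯ = T4EMLTangentInjective.Kmat h c` on the guard `{‖h_k W* − 1‖ < 1/3}` a floor `c > 0` UNIFORM in the
unitaries `h_k`, and an injectivity cover of the guard uniform in `h_k` (both: joint `C¹`-regularity of `(h, W) ↦ emlD h c W` + compactness).
-/

noncomputable section

open MeasureTheory Set Metric Function Filter
open scoped RealInnerProductSpace Topology ENNReal Pointwise Quaternion

namespace Summit.QuantumFields.YangMills.Theorems.HeightChiSqLHaarDominatedMatrix

open Literature.MathematicalPhysics.QuantumFieldTheory.Balaban1983to89.T4HaarSU2LocalDiffeo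
  (topRowQuat topRowQuat_quatMatrix topRowQuat_coe quatMatrixCLM quatMatrixCLM_apply quatMatrix_tangent apply_quatMatrix_eq_of_tangent)
open Literature.MathematicalPhysics.QuantumFieldTheory.Balaban1983to89.T4QuatExpLog (norm_quatMatrix)
open Literature.MathematicalPhysics.QuantumLattice (quatMatrix su2Quat quatToSU2 coe_quatToSU2_of_norm_eq_one quatMatrix_su2Quat)
open Literature.Geometry.GaugeTheory (quatMatrix_zero)
open Literature.MathematicalPhysics.QuantumFieldTheory (haarProbability)
open Summit.QuantumFields.YangMills.Theorems.HeightChiSqLHaarDominated (haar_restrict_map_le_smul)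

section SU2Matrix

open scoped Matrix.Norms.L2Operator

open Matrix

/-- **QUANTITATIVE LEMMA A ON `SU(2)`, MATRIX FORM.**  `S ⊆ SU(2)` open, `K : SU(2) → SU(2)` measurable, `K♯ : M₂(ℂ) → M₂(ℂ)` with, for
every `W ∈ S`, a strict real derivative `D W` at `↑W`, `K♯ ↑W = ↑(K W)`, and the TANGENT FLOOR `c‖X‖ ≤ ‖D W (↑W·X)‖` for all `X` with
`Xᴴ = −X`, `tr X = 0` (`0 < c ≤ 1`, `L²`-operator norm); and `S ⊆ ⋃_{i<n} Sᵢ` measurable with `K` injective on each `Sᵢ`.  Then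
`((Haar).restrict S).map K ≤ (n · (ofReal c⁴)⁻¹) • Haar`. [folklore] -/
theorem haar_restrict_map_le_smul_of_matrix {S : Set (Matrix.specialUnitaryGroup (Fin 2) ℂ)} (hS : IsOpen S)
    {K : Matrix.specialUnitaryGroup (Fin 2) ℂ → Matrix.specialUnitaryGroup (Fin 2) ℂ} (hK : Measurable K)
    {Kmat : Matrix (Fin 2) (Fin 2) ℂ → Matrix (Fin 2) (Fin 2) ℂ}
    {D : Matrix.specialUnitaryGroup (Fin 2) ℂ → Matrix (Fin 2) (Fin 2) ℂ →L[ℝ] Matrix (Fin 2) (Fin 2) ℂ}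
    (hd : ∀ W ∈ S, HasStrictFDerivAt Kmat (D W) (W : Matrix (Fin 2) (Fin 2) ℂ))
    (hKmat : ∀ W ∈ S, Kmat (W : Matrix (Fin 2) (Fin 2) ℂ) = ((K W : Matrix.specialUnitaryGroup (Fin 2) ℂ) : Matrix (Fin 2) (Fin 2) ℂ))
    {c : ℝ} (hc0 : 0 < c) (hc1 : c ≤ 1)
    (hfloor : ∀ W ∈ S, ∀ X : Matrix (Fin 2) (Fin 2) ℂ, Xᴴ = -X → X.trace = 0 →
      c * ‖X‖ ≤ ‖D W ((W : Matrix (Fin 2) (Fin 2) ℂ) * X)‖)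
    {n : ℕ} (piece : Fin n → Set (Matrix.specialUnitaryGroup (Fin 2) ℂ)) (hpm : ∀ i, MeasurableSet (piece i))
    (hcover : S ⊆ ⋃ i, piece i) (hinj : ∀ i, InjOn K (piece i)) :
    ((haarProbability (Matrix.specialUnitaryGroup (Fin 2) ℂ)).restrict S).map K ≤
      ((n : ℝ≥0∞) * (ENNReal.ofReal (c ^ 4))⁻¹) • haarProbability (Matrix.specialUnitaryGroup (Fin 2) ℂ) := by
  refine haar_restrict_map_le_smul hS hK (k := fun q => topRowQuat (Kmat (quatMatrix q)))
    (k' := fun u => topRowQuat.comp ((D (quatToSU2 u)).comp quatMatrixCLM)) (fun u hu huS => ?_) (fun u hu huS => ?_)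
    hc0 hc1 (fun u hu huS v hv => ?_) piece hpm hcover hinj
  · -- (i) strict derivative by the chain rule
    have h1 : HasStrictFDerivAt Kmat (D (quatToSU2 u)) (quatMatrixCLM u) := by
      rw [quatMatrixCLM_apply, ← coe_quatToSU2_of_norm_eq_one hu]
      exact hd _ huS
    exact topRowQuat.hasStrictFDerivAt.comp u
      (HasStrictFDerivAt.comp u (f := fun q : ℍ => quatMatrixCLM q) h1 quatMatrixCLM.hasStrictFDerivAt)
  · -- (ii) agreement with `K` on the unit sphere over `S`
    show topRowQuat (Kmat (quatMatrix u)) = su2Quat (K (quatToSU2 u))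
    rw [← coe_quatToSU2_of_norm_eq_one hu, hKmat _ huS, topRowQuat_coe]
  · -- (iii′) the tangent floor, read through the isometric dictionary
    obtain ⟨hXh, hXtr, hvX⟩ := quatMatrix_tangent hu hv
    have hrange := apply_quatMatrix_eq_of_tangent hS hd hKmat hu huS hv
    -- `‖k' u v‖ = ‖D W (quatMatrix v)‖`
    have hk'v : (topRowQuat.comp ((D (quatToSU2 u)).comp quatMatrixCLM)) v = topRowQuat (D (quatToSU2 u) (quatMatrix v)) := by
      simp only [ContinuousLinearMap.comp_apply, quatMatrixCLM_apply]
    have hnorm : ‖(topRowQuat.comp ((D (quatToSU2 u)).comp quatMatrixCLM)) v‖ = ‖D (quatToSU2 u) (quatMatrix v)‖ := by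
      rw [hk'v, ← norm_quatMatrix (topRowQuat (D (quatToSU2 u) (quatMatrix v))), ← hrange]
    -- `‖X‖ = ‖v‖` for `X = quatMatrix (ū v)`
    have hXn : ‖quatMatrix (star u * v)‖ = ‖v‖ := by
      rw [norm_quatMatrix, norm_mul, norm_star, hu, one_mul]
    have hfl := hfloor _ huS _ hXh hXtr
    rw [coe_quatToSU2_of_norm_eq_one hu, ← hvX, hXn] at hfl
    rw [hnorm]
    exact hfl

/-- The matrix form for the cell's `HaarData.haar`. [folklore] -/
theorem haarData_restrict_map_le_smul_of_matrix {S : Set (Matrix.specialUnitaryGroup (Fin 2) ℂ)} (hS : IsOpen S)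
    {K : Matrix.specialUnitaryGroup (Fin 2) ℂ → Matrix.specialUnitaryGroup (Fin 2) ℂ} (hK : Measurable K)
    {Kmat : Matrix (Fin 2) (Fin 2) ℂ → Matrix (Fin 2) (Fin 2) ℂ}
    {D : Matrix.specialUnitaryGroup (Fin 2) ℂ → Matrix (Fin 2) (Fin 2) ℂ →L[ℝ] Matrix (Fin 2) (Fin 2) ℂ}
    (hd : ∀ W ∈ S, HasStrictFDerivAt Kmat (D W) (W : Matrix (Fin 2) (Fin 2) ℂ))
    (hKmat : ∀ W ∈ S, Kmat (W : Matrix (Fin 2) (Fin 2) ℂ) = ((K W : Matrix.specialUnitaryGroup (Fin 2) ℂ) : Matrix (Fin 2) (Fin 2) ℂ))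
    {c : ℝ} (hc0 : 0 < c) (hc1 : c ≤ 1)
    (hfloor : ∀ W ∈ S, ∀ X : Matrix (Fin 2) (Fin 2) ℂ, Xᴴ = -X → X.trace = 0 →
      c * ‖X‖ ≤ ‖D W ((W : Matrix (Fin 2) (Fin 2) ℂ) * X)‖)
    {n : ℕ} (piece : Fin n → Set (Matrix.specialUnitaryGroup (Fin 2) ℂ)) (hpm : ∀ i, MeasurableSet (piece i))
    (hcover : S ⊆ ⋃ i, piece i) (hinj : ∀ i, InjOn K (piece i)) :
    ((Literature.MathematicalPhysics.QuantumFieldTheory.Balaban1983to89.HaarData.haar :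
        Measure (Matrix.specialUnitaryGroup (Fin 2) ℂ)).restrict S).map K ≤
      ((n : ℝ≥0∞) * (ENNReal.ofReal (c ^ 4))⁻¹) •
        (Literature.MathematicalPhysics.QuantumFieldTheory.Balaban1983to89.HaarData.haar :
          Measure (Matrix.specialUnitaryGroup (Fin 2) ℂ)) :=
  haar_restrict_map_le_smul_of_matrix hS hK hd hKmat hc0 hc1 hfloor piece hpm hcover hinj

end SU2Matrix

end Summit.QuantumFields.YangMills.Theorems.HeightChiSqLHaarDominatedMatrix

end
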